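import Mathlib
import Summits.ValiantsHypothesis.ValiantsHypothesis.Theorems.LacunarySymmetroidMatrixDescartesDoorA26WallBubblingPureDSieve
import Summits.ValiantsHypothesis.ValiantsHypothesis.Theorems.LacunarySymmetroidMatrixDescartesDoorA26WallBubblingSecondOrder

/-!
# Wall bubbling for `DoorA26` — obligation (M): the SSR lemmas (L-ix) and (L1) of the second-order sieve, kernel form

LINE / STUB.  Crux `Theses.LacunarySymmetroid.DoorA26` (stmt-ValiantsHypothesis-19979; OPEN, typed, never asserted), line
`Cruxes/DoorA26/Lines/wall_bubbling.lean`, obligation **(M) `Stmt.stub_mixedWalls`**; the line's (M)-instrument (`Lines/wall_bubbling_M-sieve.md`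
§2.5, soundness-ledger item (iv)).  Companion of `…WallBubblingSSR` (L-vi, L-iii, L-vii, L-v, L-x) and `…WallBubblingPureDSieve` (L-i): the two
remaining signed-support lemmas, as kernel theorems:
* (L-ix) `ssr_rows_proportional_of_null_orth` — two NULL letters with vanishing polar form (hence parallel, L-i) have PROPORTIONAL Gram rows:
  `G a y = c · G b y` for all `y` (same zero pattern, proportional signs);
* (L1) `det_eq_of_unique_transversal` / `det_ne_zero_of_unique_transversal` — a square matrix whose nonzero pattern admits EXACTLY ONE
  transversal has determinant `± ∏` of that transversal, hence `≠ 0`; with W3's engine lemma `SecondOrder.det_border_of_shape` (every `4 × 4` block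
  of a realisable-shaped `G = ε (v vᵀ − u uᵀ − w wᵀ)` is singular) this gives `ssr_no_unique_transversal_block`: NO `4 × 4` block of a realisable
  Gram matrix has a unique transversal of nonzero entries («rank ≥ 4, impossible in ℝ³»).
Def-free; elementary; a rung of (M) (ledger item (iv)), nothing about (M) itself.
HONEST FRAMING.  Cell `pub-symmetroid`, seat val-sym-door-p2 g11 (re-pointed W1, R2664), `--supports stmt-ValiantsHypothesis-19979 --as helper`.
(M), (W), (R) and `DoorA26` stay OPEN; registers unchanged; nothing on `MatrixDescartes` (stmt-ValiantsHypothesis-18050) or `VP ≠ VNP`. [folklore]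
-/

-- `Summit.ValiantsHypothesis.ValiantsHypothesis.…` repeats a component by the D-0017 layout
-- (single-conjunct summit), which the `dupNamespace` linter flags; the name is mandated.
set_option linter.dupNamespace false

namespace Summit.ValiantsHypothesis.ValiantsHypothesis.Theorems.LacunarySymmetroidMatrixDescartes.WallBubbling

open Matrix Finset
open scoped BigOperators

/-! ## (L-ix) parallel null letters have proportional Gram rows -/

/-- **(L-ix)**: if two `det`-null symmetric letters `S a`, `S b` (`S b ≠ 0`) have vanishing polar form, then the Gram rows of `a` and `b` are
proportional: `∃ c, ∀ y, G a y = c · G b y` for `G x y = ε · polar(S x, S y)`. [folklore] -/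
theorem ssr_rows_proportional_of_null_orth (S : Fin 6 → Matrix (Fin 2) (Fin 2) ℝ) (hS : ∀ l, (S l).IsSymm) (ε : ℝ)
    (G : Matrix (Fin 6) (Fin 6) ℝ) (hG : ∀ x y, G x y = ε * (((S x + S y).det - (S x).det - (S y).det) / 2))
    (a b : Fin 6) (ha : (S a).det = 0) (hb : (S b).det = 0) (hb0 : S b ≠ 0)
    (horth : ((S a + S b).det - (S a).det - (S b).det) / 2 = 0) :
    ∃ c : ℝ, ∀ y, G a y = c * G b y := by
  obtain ⟨c, hc⟩ := exists_smul_of_polar_eq_zero (hS a) (hS b) ha hb hb0 horth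
  refine ⟨c, fun y => ?_⟩
  rw [hG a y, hG b y, hc, polar_smul_left]
  ring

/-! ## (L1) unique transversals -/

/-- **Determinant of a matrix with a unique transversal.**  If every permutation other than `σ₀` meets a zero entry of `M`, then
`det M = sign σ₀ · ∏ᵢ M (σ₀ i) i`. [folklore] -/
theorem det_eq_of_unique_transversal {n : Type*} [Fintype n] [DecidableEq n] (M : Matrix n n ℝ) (σ₀ : Equiv.Perm n)
    (hσ : ∀ σ : Equiv.Perm n, σ ≠ σ₀ → ∃ i, M (σ i) i = 0) :
    M.det = Equiv.Perm.sign σ₀ • ∏ i, M (σ₀ i) i := by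
  rw [Matrix.det_apply]
  refine Finset.sum_eq_single σ₀ (fun σ _ hne => ?_) (fun h => absurd (Finset.mem_univ σ₀) h)
  obtain ⟨i, hi⟩ := hσ σ hne
  have hz : ∏ j, M (σ j) j = 0 := Finset.prod_eq_zero (f := fun j => M (σ j) j) (Finset.mem_univ i) hi
  rw [hz, smul_zero]

/-- **A unique transversal of nonzero entries forces `det ≠ 0`.** [folklore] -/
theorem det_ne_zero_of_unique_transversal {n : Type*} [Fintype n] [DecidableEq n] (M : Matrix n n ℝ) (σ₀ : Equiv.Perm n)
    (h0 : ∀ i, M (σ₀ i) i ≠ 0) (hσ : ∀ σ : Equiv.Perm n, σ ≠ σ₀ → ∃ i, M (σ i) i = 0) : M.det ≠ 0 := by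
  rw [det_eq_of_unique_transversal M σ₀ hσ]
  have hprod : ∏ i, M (σ₀ i) i ≠ 0 := Finset.prod_ne_zero_iff.mpr fun i _ => h0 i
  intro h
  rcases Int.units_eq_one_or (Equiv.Perm.sign σ₀) with hs | hs
  · rw [hs, one_smul] at h; exact hprod h
  · rw [hs, Units.neg_smul, one_smul, neg_eq_zero] at h; exact hprod h

/-- **(L1)**: no `4 × 4` block (rows `r`, columns `c`, repetitions allowed) of a realisable-shaped matrix `G = ε • (v vᵀ − u uᵀ − w wᵀ)` has a
unique transversal of nonzero entries — such a block would have nonzero determinant, while every `4 × 4` block of a rank-3 shape is singular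
(`SecondOrder.det_border_of_shape`, W3's engine). [folklore] -/
theorem ssr_no_unique_transversal_block (ε : ℝ) (v u w : Fin 6 → ℝ) (G : Matrix (Fin 6) (Fin 6) ℝ)
    (hG : G = ε • (vecMulVec v v - vecMulVec u u - vecMulVec w w)) (r c : Fin 3 ⊕ Unit → Fin 6)
    (σ₀ : Equiv.Perm (Fin 3 ⊕ Unit)) (h0 : ∀ i, G (r (σ₀ i)) (c i) ≠ 0)
    (hσ : ∀ σ : Equiv.Perm (Fin 3 ⊕ Unit), σ ≠ σ₀ → ∃ i, G (r (σ i)) (c i) = 0) : False := by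
  have hblock : (Matrix.of fun a b : Fin 3 ⊕ Unit => G (r a) (c b)) =
      Matrix.of fun a b : Fin 3 ⊕ Unit => ε * (v (r a) * v (c b) - u (r a) * u (c b) - w (r a) * w (c b)) := by
    ext a b
    simp only [Matrix.of_apply, hG, Matrix.smul_apply, Matrix.sub_apply, vecMulVec_apply, smul_eq_mul]
  have hdet0 : (Matrix.of fun a b : Fin 3 ⊕ Unit => G (r a) (c b)).det = 0 := by
    rw [hblock]; exact SecondOrder.det_border_of_shape ε v u w r c
  have hne := det_ne_zero_of_unique_transversal (Matrix.of fun a b : Fin 3 ⊕ Unit => G (r a) (c b)) σ₀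
    (fun i => by simpa using h0 i) (fun σ hσ' => by
      obtain ⟨i, hi⟩ := hσ σ hσ'
      exact ⟨i, by simpa using hi⟩)
  exact hne hdet0

end Summit.ValiantsHypothesis.ValiantsHypothesis.Theorems.LacunarySymmetroidMatrixDescartes.WallBubbling
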